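import Summits.AtomisticToContinuum.Crystallization.Theorems.FrustratedLawDichotomyStrainedPatchHomExteriorLeafSem
import Summits.AtomisticToContinuum.Crystallization.Theorems.FrustratedLawDichotomyStrainedPatchHomExteriorAnnulus

/-!
# Strained patch, `(H)` hcp certificate (architecture R3) — THE FULL COLUMN MENU: listed cells | kernel far-field/force leaves | exterior slabs | annulus leaves, in ONE
# cut tree closed by ONE `decide` (G4′ one-column smoke / the root manifest; decomp-a2c hand 2, generation 39; structural #16)

`semOKH_of_annulusOK` (one line over `semOKH_of_sound` ∘ `annulusOK_sound`, p854114), the leaf data `AnnLeafData`, the four-kind menu `colLeaf4 L μ₀` and its fold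
`semOKH_of_cutOK_colLeaf4` / `semOKH_root_of_colManifest4` (`semOKH_of_cutOK_leaves`, p854068).  This is the consumer hand-1's column generator targets:
`semOKH_root_of_colManifest4 hle L hL t (by decide)` with `t : CutTree _ (ℕ ⊕ Unit ⊕ ExtLeafData ⊕ AnnLeafData)`.  0 sorry; standard axioms.
`--supports stmt-AtomisticToContinuum-27623`.  [formal bookkeeping]
-/

namespace Summit.AtomisticToContinuum.Crystallization.Theorems.FrustratedLawDichotomyStrainedPatchHomExteriorRay

open Summit.AtomisticToContinuum.Crystallization.Theorems.FrustratedLawDichotomyStrainedPatchHomEntryGramHcp (rootCH rootWH)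
open Summit.AtomisticToContinuum.Crystallization.Theorems.FrustratedLawDichotomyStrainedPatchHomEntryLeafHT (semOKH semOKH_of_sound semOKH_anti_box)
open Summit.AtomisticToContinuum.Crystallization.Theorems.FrustratedLawDichotomyStrainedPatchHomForceCentredHcp (entryLeafOKHC)
open Summit.AtomisticToContinuum.Crystallization.Theorems.FrustratedLawDichotomyStrainedPatchHomCutTree (CutTree cutOK coveredAt coveredAt_sound
  semOKH_of_cutOK_leaves semOKH_of_entryLeafOKHC_level)

/-- ★★★ **AN ACCEPTED ANNULUS / SIGNED-FLOOR EXTERIOR LEAF IS A SEMANTIC FACT AT EVERY LEVEL `μ`.** [formal bookkeeping] -/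
theorem semOKH_of_annulusOK {J : Fin 3 → Fin 3 × Fin 3 → ℤ} {cC wC cH wH : Bx} {ch : List (Bx × Bx × (Fin 3 → Fin 3 → ℤ) × ℤ)} {ll : List ℤ} {den : ℤ}
    {na nb : List ℤ} {g : ℤ} {i : Fin 3} {c w : Bx} (h : annulusOK J cC wC cH wH ch ll den na nb g i c w = true) (μ : ℤ) : semOKH μ c w = true :=
  semOKH_of_sound (μ := μ) (fun c w => annulusOK J cC wC cH wH ch ll den na nb g i c w)
    (fun _ _ hv U ξ hsa hU hbox hξ h0 h2 => annulusOK_sound hv U ξ hsa hU hbox hξ h0 h2) h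

/-- The certificate data of one annulus / signed-floor exterior leaf. -/
structure AnnLeafData where
  /-- the cell's affine tilt -/
  J : Fin 3 → Fin 3 × Fin 3 → ℤ
  /-- the cell box -/
  cC : Bx
  /-- the cell box half-widths -/
  wC : Bx
  /-- the hull box -/
  cH : Bx
  /-- the hull box half-widths -/
  wH : Bx
  /-- the nested box chain -/
  ch : List (Bx × Bx × (Fin 3 → Fin 3 → ℤ) × ℤ)
  /-- the per-box signed floors -/
  ll : List ℤ
  /-- the dwell denominator -/
  den : ℤ
  /-- the dwell lower numerators -/
  na : List ℤ
  /-- the dwell upper numerators -/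
  nb : List ℤ
  /-- the cell/slab gap -/
  g : ℤ
  /-- the gap coordinate -/
  i : Fin 3

/-- **THE FOUR-KIND COLUMN LEAF MENU**: `inl i` listed landed cell `L[i]`; `inr (inl ())` kernel leaf `entryLeafOKHC μ₀`; `inr (inr (inl e))` exterior slab; `inr (inr (inr a))`
annulus / signed-floor exterior.  Computable. -/
def colLeaf4 (L : List (Bx × Bx)) (μ₀ : ℤ) : ℕ ⊕ (Unit ⊕ (ExtLeafData ⊕ AnnLeafData)) → Bx → Bx → Bool
  | .inl i, c, w => coveredAt L i c w
  | .inr (.inl _), c, w => entryLeafOKHC μ₀ c w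
  | .inr (.inr (.inl e)), c, w => exteriorOK e.J e.cC e.wC e.cH e.wH e.ch e.lmin e.g e.i c w
  | .inr (.inr (.inr a)), c, w => annulusOK a.J a.cC a.wC a.cH a.wH a.ch a.ll a.den a.na a.nb a.g a.i c w

/-- ★★ **THE FOUR-KIND MENU FOLD**: listed cells certified at `μ`, kernel leaves at `μ₀ ≥ μ`, exterior and annulus leaves (every level) + ONE `decide` ⟹ `semOKH μ c w`.
[formal bookkeeping] -/
theorem semOKH_of_cutOK_colLeaf4 {μ μ₀ : ℤ} (hle : μ ≤ μ₀) (L : List (Bx × Bx)) (hL : ∀ b ∈ L, semOKH μ b.1 b.2 = true) :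
    ∀ (t : CutTree ((Fin 3 × Fin 3) ⊕ Fin 3) (ℕ ⊕ (Unit ⊕ (ExtLeafData ⊕ AnnLeafData)))) (c w : Bx), cutOK (colLeaf4 L μ₀) t c w = true → semOKH μ c w = true :=
  semOKH_of_cutOK_leaves (colLeaf4 L μ₀) fun a c w h => by
    rcases a with i | u | e | a
    · exact coveredAt_sound (semOKH μ) (fun _ _ _ _ hc h => semOKH_anti_box hc h) L hL i c w h
    · exact semOKH_of_entryLeafOKHC_level hle h
    · exact semOKH_of_exteriorOK h μ
    · exact semOKH_of_annulusOK h μ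

/-- ★★★ **THE hcp ROOT FACT FROM A FOUR-KIND COLUMN MANIFEST** (the G4′ smoke / production root consumer). [formal bookkeeping] -/
theorem semOKH_root_of_colManifest4 {μ μ₀ : ℤ} (hle : μ ≤ μ₀) (L : List (Bx × Bx)) (hL : ∀ b ∈ L, semOKH μ b.1 b.2 = true)
    (t : CutTree ((Fin 3 × Fin 3) ⊕ Fin 3) (ℕ ⊕ (Unit ⊕ (ExtLeafData ⊕ AnnLeafData)))) (h : cutOK (colLeaf4 L μ₀) t rootCH rootWH = true) :
    semOKH μ rootCH rootWH = true :=
  semOKH_of_cutOK_colLeaf4 hle L hL t rootCH rootWH h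

end Summit.AtomisticToContinuum.Crystallization.Theorems.FrustratedLawDichotomyStrainedPatchHomExteriorRay
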